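import Mathlib
import HarnessLib
import Summits.AtomisticToContinuum.Crystallization.Theses.ThreeConeCertificate
import Literature.MathematicalPhysics.StatisticalMechanics.LennardJonesClusters
import Literature.MathematicalPhysics.StatisticalMechanics.BarlowStacking

/-!
# Sketch — crux-ideate round 1, ideator k = 2, crux `SlackRigidity` (stmt-AtomisticToContinuum-11960)

First lemmas (as `def … : Prop`, elaborating over existing declarations) for three crux idea cards:

* `Ekeland`   — Hamming–Ekeland regularisation: near-minimisers ⇝ λ-quasi-ground-states;
* `TwoCone`   — f-free reduction: the joint equality set of the localisable cones decides SR;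
* `RodParseval` — the positive-type cone prices cubic letters only through hcp-absent reflections;
                  a 1-D spectral fault count on Hägg words.

Nothing here is a skeleton; no `sorry` is used (statements only, plus two small sanity proofs).
-/

noncomputable section

open scoped BigOperators
open Literature.MathematicalPhysics.StatisticalMechanics

namespace Summit.AtomisticToContinuum.Crystallization.Cruxes.SlackRigidity

/-- Shorthand for `ℝ³`. -/
abbrev E3 := EuclideanSpace ℝ (Fin 3)

/-- Hamming distance between two labelled `N`-point configurations. -/
def hammingDist {N : ℕ} (x y : Fin N → E3) : ℕ :=
  (Finset.univ.filter fun i => x i ≠ y i).card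

/-- The two-way `(R, ε)`-matching predicate of `SlackRigidity` / `BulkDefectVanish` for particle `i`
of `x` against the periodic template `P` (verbatim the predicate negated inside the route decl). -/
def IsGoodParticle (P : PeriodicConfiguration 3) (R ε : ℝ) {N : ℕ} (x : Fin N → E3) (i : Fin N) :
    Prop :=
  ∃ A : E3 →ₗᵢ[ℝ] E3,
    (∀ p ∈ P.points, ‖p‖ ≤ R → ∃ j : Fin N, dist (x j) (x i + A p) ≤ ε) ∧
    (∀ j : Fin N, dist (x j) (x i) ≤ R → ∃ p ∈ P.points, dist (x j) (x i + A p) ≤ ε)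

/-- Number of `(R, ε)`-bad particles. -/
def badCount (P : PeriodicConfiguration 3) (R ε : ℝ) {N : ℕ} (x : Fin N → E3) : ℕ :=
  Nat.card {i : Fin N // ¬ IsGoodParticle P R ε x i}

/-- The crux, restated through `badCount` (definitionally the route decl; see `slackRigidity_iff`). -/
theorem slackRigidity_iff :
    Summit.AtomisticToContinuum.Crystallization.Theses.ThreeConeCertificate.SlackRigidity ↔
      ∃ P : PeriodicConfiguration 3, ∀ R ε : ℝ, 0 < R → 0 < ε →
        ∀ x : (N : ℕ) → (Fin N → E3), (∀ N, Function.Injective (x N)) →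
          Filter.Tendsto (fun N : ℕ => (interactionEnergy lennardJones (x N) -
            groundStateEnergy lennardJones 3 N) / N) Filter.atTop (nhds 0) →
          Filter.Tendsto (fun N : ℕ => (badCount P R ε (x N) : ℝ) / N) Filter.atTop (nhds 0) :=
  Iff.rfl

/-! ## Card 1 — `ekeland-quasi-ground-states` -/
namespace Ekeland

/-- A **λ-quasi-ground-state** (Hamming–Ekeland point): `N` distinct points such that no relocation
of `k` particles lowers the Lennard-Jones energy by more than `k·λ`. For `λ = 0` this is exactly
`IsGroundState lennardJones` (`isQuasiGroundState_zero_iff`). -/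
def IsQuasiGroundState (lam : ℝ) {N : ℕ} (x : Fin N → E3) : Prop :=
  Function.Injective x ∧
    ∀ y : Fin N → E3, Function.Injective y →
      interactionEnergy lennardJones x - lam * (hammingDist y x : ℝ) ≤ interactionEnergy lennardJones y

/-- Sanity: `0`-quasi-ground-states are the ground states. -/
theorem isQuasiGroundState_zero_iff {N : ℕ} (x : Fin N → E3) :
    IsQuasiGroundState 0 x ↔ IsGroundState lennardJones x := by
  constructor
  · rintro ⟨hx, h⟩
    refine ⟨hx, le_antisymm ?_ (groundStateEnergy_lennardJones_le hx)⟩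
    haveI : Nonempty {y : Fin N → E3 // Function.Injective y} := ⟨⟨x, hx⟩⟩
    refine le_ciInf fun y => ?_
    have := h y.1 y.2
    simpa using this
  · rintro ⟨hx, hE⟩
    refine ⟨hx, fun y hy => ?_⟩
    have := groundStateEnergy_lennardJones_le (d := 3) hy
    simp only [zero_mul, sub_zero]
    linarith

/-- A quasi-ground-state is a near-minimiser: excess `≤ λ N`. -/
theorem IsQuasiGroundState.energy_le {lam : ℝ} (hlam : 0 ≤ lam) {N : ℕ} {x : Fin N → E3}
    (hx : IsQuasiGroundState lam x) {y : Fin N → E3} (hy : Function.Injective y) :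
    interactionEnergy lennardJones x ≤ interactionEnergy lennardJones y + lam * N := by
  have h := hx.2 y hy
  have hcard : (hammingDist y x : ℝ) ≤ N := by
    have : hammingDist y x ≤ N := by
      unfold hammingDist
      exact (Finset.card_filter_le _ _).trans (by simp)
    exact_mod_cast this
  nlinarith [mul_le_mul_of_nonneg_left hcard hlam]

/-- **First lemma (E1): Hamming–Ekeland.** A configuration with energy excess `η N` becomes, after
changing at most `η N / λ` particles and without raising the energy, a `λ`-quasi-ground-state.
(Proof route: strong induction on `⌊(E(x) − E(N))/λ⌋₊`; each improving relocation lowers the energy by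
more than `λ`; no completeness argument is needed for the Hamming metric.) -/
def HammingEkeland : Prop :=
  ∀ (N : ℕ) (η lam : ℝ), 0 ≤ η → 0 < lam → ∀ x : Fin N → E3, Function.Injective x →
    interactionEnergy lennardJones x ≤ groundStateEnergy lennardJones 3 N + η * N →
    ∃ x' : Fin N → E3, IsQuasiGroundState lam x' ∧
      interactionEnergy lennardJones x' ≤ interactionEnergy lennardJones x ∧
      (hammingDist x' x : ℝ) ≤ η * N / lam

/-- **(E2) Quasi-ground-states are uniformly separated** (`δ = 1/3`, every `λ ≤ 10⁴`): the tree's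
proof of `LennardJonesMinimalDistance_holds` with the removal inequality weakened to
`siteEnergy ≤ λ` (one-particle relocation = Hamming distance 1); spare gain `729·(729 − 500)/12 > 10⁴`. -/
def QuasiGroundStateSeparation : Prop :=
  ∀ (N : ℕ) (lam : ℝ), lam ≤ 10 ^ 4 → ∀ x : Fin N → E3, IsQuasiGroundState lam x →
    ∀ i j : Fin N, i ≠ j → (1 / 3 : ℝ) ≤ dist (x i) (x j)

/-- **(E3) Bad counts move by `O(Hamming distance)`** when the modified configuration is separated
(window radius grows by `1`; the constant is a packing number `C(R, δ)`). -/
def BadCountTransfer : Prop :=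
  ∀ (P : PeriodicConfiguration 3) (R ε δ : ℝ), 0 < R → 0 < ε → 0 < δ → ∃ C : ℝ,
    ∀ (N : ℕ) (x x' : Fin N → E3), (∀ i j : Fin N, i ≠ j → δ ≤ dist (x' i) (x' j)) →
      (badCount P R ε x : ℝ) ≤ badCount P (R + 1) ε x' + C * hammingDist x' x

/-- **Transfer target C⁺ — quasi-ground-state rigidity.** `SlackRigidity` with the energy hypothesis
REPLACED by quasi-minimality with `λ_N → 0` (which implies excess `≤ λ_N N = o(N)`): equivalent to the
crux (`Transfer` below and the trivial converse), and literally `BulkDefectVanish` (hinge 0751) when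
`λ_N ≡ 0`. -/
def QuasiGroundStateRigidity : Prop :=
  ∃ P : PeriodicConfiguration 3, ∀ R ε : ℝ, 0 < R → 0 < ε →
    ∀ (lam : ℕ → ℝ) (x : (N : ℕ) → (Fin N → E3)),
      (∀ N, 0 ≤ lam N) → (∀ N, IsQuasiGroundState (lam N) (x N)) →
      Filter.Tendsto lam Filter.atTop (nhds 0) →
      Filter.Tendsto (fun N : ℕ => (badCount P R ε (x N) : ℝ) / N) Filter.atTop (nhds 0)

/-- The reduction this card delivers (all three hypotheses provable now; sizes M, M, M). -/
def Transfer : Prop :=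
  HammingEkeland → QuasiGroundStateSeparation → BadCountTransfer →
    QuasiGroundStateRigidity →
      Summit.AtomisticToContinuum.Crystallization.Theses.ThreeConeCertificate.SlackRigidity

/-- The trivial converse direction (quasi-ground-states with `λ_N → 0` are near-minimisers), recorded
as a statement: the crux and C⁺ are equivalent. -/
def Converse : Prop :=
  Summit.AtomisticToContinuum.Crystallization.Theses.ThreeConeCertificate.SlackRigidity →
    QuasiGroundStateRigidity

end Ekeland

/-! ## Card 2 — `two-cone-strictness-census` -/
namespace TwoCone

/-- The clauses of `ExactCertificate` for given data (copied from the route decl). -/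
def IsExactCertificate (P : PeriodicConfiguration 3) (ρ c : ℝ) (g U f : ℝ → ℝ) : Prop :=
  (∀ r : ℝ, 0 < r → lennardJones r = g r + U r + f r) ∧ (∀ r : ℝ, 0 < r → 0 ≤ U r) ∧
  (∀ r : ℝ, ρ ≤ r → g r = 0) ∧
  (∀ (n : ℕ) (y : Fin n → E3) (w : Fin n → ℝ), 0 ≤ ∑ i, ∑ j, w i * w j * f (dist (y i) (y j))) ∧
  (∀ (N : ℕ) (x : Fin N → E3), Function.Injective x →
    -(c * (N : ℝ)) ≤ interactionEnergy g x) ∧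
  c + f 0 / 2 = -(P.energyPerParticle lennardJones)

/-- The localisable two-cone part of the pair energy: `g` plus the slack `U` truncated at `ρ'`. -/
def twoConeEnergy (ρ' : ℝ) (g U : ℝ → ℝ) {N : ℕ} (x : Fin N → E3) : ℝ :=
  interactionEnergy (fun r => g r + if r ≤ ρ' then U r else 0) x

/-- **TwoConeDefectGap** — the f-free strengthening of `ExactCertificate` under which `SlackRigidity`
is counting: the finite-range two-cone energy is not only `c`-stable but COERCIVE in the number of
particles whose `ρ'`-environment is not `ε'`-matched to the template (for every `ε'`, some `κ > 0`).
Equivalently: the joint equality set of the localisable cones is the `O(3)`-orbit of the template's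
`ρ'`-environment (compactness turns that into `κ(ε') > 0`). -/
def TwoConeDefectGap : Prop :=
  ∃ (P : PeriodicConfiguration 3) (ρ ρ' c : ℝ) (g U f : ℝ → ℝ),
    IsExactCertificate P ρ c g U f ∧ ρ ≤ ρ' ∧
    ∀ ε' : ℝ, 0 < ε' → ∃ κ : ℝ, 0 < κ ∧ ∀ (N : ℕ) (x : Fin N → E3), Function.Injective x →
      -(c * (N : ℝ)) + κ * badCount P ρ' ε' x ≤ twoConeEnergy ρ' g U x

/-- **First lemma (provable now): excess controls local defects.** Under `TwoConeDefectGap` with data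
`(P, ρ', …)`, for every `ε'` there is `κ > 0` with `κ · #Bad_{ρ',ε'}(x) ≤ E(x) − N e(P)` for every finite
configuration of distinct points — `CertificateBound`'s three-line proof carrying the defect term
(the far slack `U·1_{(ρ',∞)} ≥ 0` and the Bochner form with unit weights are simply dropped). -/
def ExcessControlsDefects : Prop :=
  ∀ (P : PeriodicConfiguration 3) (ρ ρ' c : ℝ) (g U f : ℝ → ℝ),
    IsExactCertificate P ρ c g U f → ρ ≤ ρ' →
    ∀ ε' κ : ℝ, (∀ (N : ℕ) (x : Fin N → E3), Function.Injective x →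
        -(c * (N : ℝ)) + κ * badCount P ρ' ε' x ≤ twoConeEnergy ρ' g U x) →
      ∀ (N : ℕ) (x : Fin N → E3), Function.Injective x →
        κ * badCount P ρ' ε' x ≤
          interactionEnergy lennardJones x - N * P.energyPerParticle lennardJones

/-- **Window upgrade** (chart gluing for the template `P` at chart radius `ρ'`): if every particle within
`R'` of `i` carries an `ε'`-matched `ρ'`-chart, then `i` carries an `ε`-matched `R`-window. For
`P = hcp(a*, h*)` and `ρ' ≥ 2a*` overlapping charts share an affinely spanning set of ≥ 30 template
points, so relative isometries are pinned up to the finite site stabiliser and the developing map into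
the template is single-valued on balls. -/
def WindowUpgrade (P : PeriodicConfiguration 3) (ρ' : ℝ) : Prop :=
  ∀ R ε : ℝ, 0 < R → 0 < ε → ∃ R' ε' : ℝ, 0 < ε' ∧
    ∀ (N : ℕ) (x : Fin N → E3), Function.Injective x → ∀ i : Fin N,
      (∀ j : Fin N, dist (x j) (x i) ≤ R' → IsGoodParticle P ρ' ε' x j) → IsGoodParticle P R ε x i

/-- **Counting glue**: with the window upgrade, `(R, ε)`-bad particles are at most a packing constant
times the `(ρ', ε')`-bad ones (good particles are isolated, so each bad particle spoils `≤ C(R')`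
good ones). -/
def CountingGlue (P : PeriodicConfiguration 3) (ρ' : ℝ) : Prop :=
  WindowUpgrade P ρ' → ∀ R ε : ℝ, 0 < R → 0 < ε → ∃ C ε' : ℝ, 0 < ε' ∧
    ∀ (N : ℕ) (x : Fin N → E3), Function.Injective x →
      (badCount P R ε x : ℝ) ≤ C * badCount P ρ' ε' x

/-- The shape of the line: two-cone defect gap + window upgrade for its template + the trial-state
upper bound (route support item `TrialStateUpper`, needed to turn `E(x^N) − N e(P)` into
excess `+ o(N)`) ⇒ the crux. -/
def LineShape : Prop :=
  ExcessControlsDefects →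
  (∀ (P : PeriodicConfiguration 3) (ρ' : ℝ), CountingGlue P ρ') →
  Summit.AtomisticToContinuum.Crystallization.Theses.ThreeConeCertificate.TrialStateUpper →
  (∃ (P : PeriodicConfiguration 3) (ρ ρ' c : ℝ) (g U f : ℝ → ℝ),
    IsExactCertificate P ρ c g U f ∧ ρ ≤ ρ' ∧ WindowUpgrade P ρ' ∧
    ∀ ε' : ℝ, 0 < ε' → ∃ κ : ℝ, 0 < κ ∧ ∀ (N : ℕ) (x : Fin N → E3), Function.Injective x →
      -(c * (N : ℝ)) + κ * badCount P ρ' ε' x ≤ twoConeEnergy ρ' g U x) →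
  Summit.AtomisticToContinuum.Crystallization.Theses.ThreeConeCertificate.SlackRigidity

/-- Arithmetic behind the `U`-channel fault detector (ideal `c/a`, unit in-layer spacing): the fcc-only
squared distance `8` is not an hcp squared distance `ℓ + (2/3) m²` — `ℓ = i²+ij+j²` (Löschian) for `m`
even, `ℓ = i²+ij+j²+i+j + 1/3` for `m` odd; only `m ≤ 3` and `|i|, |j| ≤ 4` can reach `8`, and on that
box (multiplying by `3`): `L ≠ 8` (`m = 0`), `3L + 8 ≠ 24` (`m = 2`), `3L' + 3 ≠ 24` (`m = 1`),
`3L' + 19 ≠ 24` (`m = 3`). Nearest hcp values: `22/3` and `25/3`. -/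
theorem eight_not_hcp_sq_dist :
    ∀ i j : Fin 9,
      (((i : ℕ) : ℤ) - 4) ^ 2 + (((i : ℕ) : ℤ) - 4) * (((j : ℕ) : ℤ) - 4) + (((j : ℕ) : ℤ) - 4) ^ 2 ≠ 8 ∧
      3 * ((((i : ℕ) : ℤ) - 4) ^ 2 + (((i : ℕ) : ℤ) - 4) * (((j : ℕ) : ℤ) - 4) +
        (((j : ℕ) : ℤ) - 4) ^ 2) + 8 ≠ 24 ∧
      3 * ((((i : ℕ) : ℤ) - 4) ^ 2 + (((i : ℕ) : ℤ) - 4) * (((j : ℕ) : ℤ) - 4) +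
        (((j : ℕ) : ℤ) - 4) ^ 2 + (((i : ℕ) : ℤ) - 4) + (((j : ℕ) : ℤ) - 4)) + 3 ≠ 24 ∧
      3 * ((((i : ℕ) : ℤ) - 4) ^ 2 + (((i : ℕ) : ℤ) - 4) * (((j : ℕ) : ℤ) - 4) +
        (((j : ℕ) : ℤ) - 4) ^ 2 + (((i : ℕ) : ℤ) - 4) + (((j : ℕ) : ℤ) - 4)) + 19 ≠ 24 := by
  decide

end TwoCone

/-! ## Card 3 — `rod-parseval-fault-pricing` -/
namespace RodParseval

/-- The layer phase `z_m = ω^{L(m)}`, `ω = e^{2πi/3}`, `L = haggLabel s` (position letter of layer `m`). -/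
def layerPhase (s : ℤ → ℤ) (m : ℤ) : ℂ :=
  Complex.exp (2 * Real.pi * Complex.I * (haggLabel s m : ℂ) / 3)

/-- The rod amplitude of the word on layers `0, …, M−1`: `ẑ(θ) = Σ_m z_m e^{iθm}` (the structure factor
of a laterally coherent stack restricted to the first non-extinct rod is `n · ẑ(k_z h)`). -/
def rodAmplitude (s : ℤ → ℤ) (M : ℕ) (θ : ℝ) : ℂ :=
  ∑ m ∈ Finset.range M, layerPhase s m * Complex.exp (Complex.I * θ * m)

/-- Layer `m` is a **cubic letter** (`c`) of the Hägg sequence `s` iff the two shifts around it agree. -/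
def IsCubicLetter (s : ℤ → ℤ) (m : ℤ) : Prop := s m = s (m - 1)

open Classical in
/-- Number of layers among `0,…,M−1` within `D` of an INTERIOR cubic letter of the window (letters at
`1 ≤ m' ≤ M−2` are determined by shifts inside the window). -/
def nearCubicCount (s : ℤ → ℤ) (M D : ℕ) : ℕ :=
  ((Finset.range M).filter fun m : ℕ =>
    ∃ m' ∈ Finset.range M, 1 ≤ m' ∧ m' + 2 ≤ M ∧ IsCubicLetter s m' ∧ |(m : ℤ) - m'| ≤ D).card

open Classical in
/-- Number of interior cubic letters of the window. -/
def cubicCount (s : ℤ → ℤ) (M : ℕ) : ℕ :=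
  ((Finset.range M).filter fun m' : ℕ => 1 ≤ m' ∧ m' + 2 ≤ M ∧ IsCubicLetter s m').card

/-- Spectral mass of the word off the `τ`-neighbourhoods of the hcp rod peaks `θ ∈ {0, π}` (mod `2π`). -/
def offPeakMass (s : ℤ → ℤ) (M : ℕ) (τ : ℝ) : ℝ :=
  ∫ θ in Set.Icc τ (Real.pi - τ) ∪ Set.Icc (Real.pi + τ) (2 * Real.pi - τ),
    ‖rodAmplitude s M θ‖ ^ 2

/-- **First lemma (provable now; Parseval for the second difference).** For a Hägg word,
`Σ_m |z_{m+2} − z_m|² = 3·#(cubic letters) + 4 = (1/2π) ∫₀^{2π} 4 sin²θ |ẑ(θ)|² dθ`, and `sin²θ ≤ sin²τ`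
on the `τ`-neighbourhoods of `{0, π}`, whence
`#c ≤ (4/3) sin²τ · M + (2/(3π)) · offPeakMass τ` and `nearCubicCount ≤ (2D+1)·#c`.
Qualitatively this is all the line needs: `offPeakMass(τ) = o(M)` for every fixed `τ` forces
`#c = o(M)` (let `τ → 0` after `M → ∞`). -/
def WordParsevalFaultBound : Prop :=
  ∀ s : ℤ → ℤ, IsHaggSeq s → ∀ (M D : ℕ) (τ : ℝ), 0 < τ → τ ≤ Real.pi / 2 →
    (cubicCount s M : ℝ) ≤ 4 / 3 * Real.sin τ ^ 2 * M + 2 / (3 * Real.pi) * offPeakMass s M τ ∧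
    (nearCubicCount s M D : ℝ) ≤ (2 * D + 1) * cubicCount s M

/-- **Conjectured sharp form (kit-checkable by enumeration of words, not load-bearing):** no `τ² M`
term — local aperiodicity at scale `D` forces off-peak mass at rate `1/(D + 1/τ)` (dilute periodic twins
at spacing `p` carry off-`τ` mass `≍ F · min(p, 1/τ)`). -/
def WordSpectralFaultCount : Prop :=
  ∃ C : ℝ, 0 < C ∧ ∀ τ : ℝ, 0 < τ → τ ≤ Real.pi / 3 → ∀ (D M : ℕ) (s : ℤ → ℤ), IsHaggSeq s →
    (nearCubicCount s M D : ℝ) ≤ C * (D + 1 / τ) * offPeakMass s M τ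

/-- Parseval on the rod: the total rod mass of ANY word of length `M` is `2π M` (stacking-independent);
the hcp word puts all of it, up to edge leakage, at `θ ∈ {0, π}`. Sanity statement for the line. -/
def RodParsevalIdentity : Prop :=
  ∀ (s : ℤ → ℤ) (M : ℕ), ∫ θ in Set.Icc 0 (2 * Real.pi), ‖rodAmplitude s M θ‖ ^ 2 = 2 * Real.pi * M

/-- Which sphere radii can price a cubic letter (ideal `c/a`, unit in-layer spacing, units `π²/a²` for
`|k|²`): the hcp-PRESENT reflections have `|k|² = (16/3)·N(G) + (3/2)·ℓ²` (`N` Löschian, extinction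
`h − k ≡ 0 (3) ∧ ℓ odd`), and the fcc reflections have `|k|² ∈ 2·{3, 4, 8, 11, 12, 16, 19, 20, 24, …}`.
The coincidences `6, 16, 22, 24, 40, 48` are forced zeros of a radial `f̂`; `8 = (200)_fcc`,
`32 = (400)_fcc`, `38 = (331)_fcc` are NOT hcp radii — checked on the finite index box below
(`N ≤ 48/ (16/3)` ⇒ Löschian values `{0,1,3,4,7,9}`, `ℓ ≤ 5`). -/
theorem fcc200_not_hcp_radius :
    ∀ N ∈ ({0, 1, 3, 4, 7, 9} : Finset ℕ), ∀ ℓ : Fin 7,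
      32 * (N : ℤ) + 9 * (ℓ : ℤ) ^ 2 ≠ 6 * 8 ∧ 32 * (N : ℤ) + 9 * (ℓ : ℤ) ^ 2 ≠ 6 * 32 ∧
        32 * (N : ℤ) + 9 * (ℓ : ℤ) ^ 2 ≠ 6 * 38 := by
  decide

end RodParseval

end Summit.AtomisticToContinuum.Crystallization.Cruxes.SlackRigidity

end
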